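import Literature.AnabelianGeometry.EtaleTheta.SettingModelChiSemidirect
import Literature.AnabelianGeometry.EtaleTheta.SettingModelChiShearInner
import Literature.AnabelianGeometry.EtaleTheta.ZHatLevelDetermination
import Literature.AnabelianGeometry.SemiGraphs.TemperedCurveHyperbolicWitness
import Literature.AnabelianGeometry.SemiGraphs.ProfiniteCompletionEta
import HarnessLib

/-!
# The χ-twisted root model with an extra Tate lattice: `Π^tp_X := (Γ × Ẑ(1)²) ⋊_χ G_{ℚ_p}` — carrier and
# tempered-curve layer (file 1 of the F-2633 closure certificate «F2633-SWAP-TOWER»)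

Mochizuki, *The étale theta function …*, Publ. RIMS **45** (2009) [EtTh], §1, PRIMS PDF pp. 11–12
[cite: MochizukiEtTh2009, §1 p.12] ("`Π^tp_X`", the extension `1 → Δ^tp_X → Π^tp_X → G_K → 1`,
"`Π_X := (Π^tp_X)^∧`"); [SemiAnbd] §6 p. 69 [cite: MochizukiSemiAnbd2006, §6 p.69].

LATTICE TWIST OF `Ẑ(1)²` — NOT the (B) section twist: this file adjoins an inert Tate lattice `Ẑ(1)²` to the
χ-twisted root carrier; it is a distinct object from abc-iut-L2-t6's `SettingModelChiTwistedSections.lean` (twisted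
SECTIONS of the same carrier), cf. abc-iut-L2-lead R709.

abc-iut cell, K-L6 slice, row «KL6-CLOSURE-CERT F-2633» (abc-iut-L6-lead §F 2026-08-26T21:44:04Z «GO-LONG L6-t19
F2633-SWAP-TOWER»), seat abc-iut-L6-t19 (gen 8).  PURPOSE: a SECOND semi-synthetic inhabitant of the [EtTh] §1 root
interface `ThetaSetting p` carrying Kummer data, designed so that its `Π^tp_Ÿ` is NOT characteristic — the universal
closure of the named hypothesis (H1) `PiYddCharacteristic` ([IUTchII] Prop. 1.4, FACT-LIST F-2633) is then refuted at it
(files 2–3; census HOME/staging/L6/L6-t19/F2633-CLOSURE-CENSUS.md, sha16 d037f629a1e9ea81).  THIS FILE = the carrier and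
the [SemiAnbd] §6 tempered-curve layer only, built BY NAME over abc-iut-w5-d249's `PiTpχ`/`PiHtχ` pattern
(`SettingModelChiSemidirect`, generic `Semidirect.*` topology of `SettingModelSemidirectTopology`), abc-iut-L2-t1's
`Gfp`/`gfpFst`/`actχ`/`chi`, and abc-iut-w5-d091's level characters (`ZHatLevel.*`):

* `Latt := Ẑ × Ẑ` with the DIAGONAL cyclotomic action `actLatt σ := χ(σ) × χ(σ)` — "`Ẑ(1)²`"; the action is jointly
  continuous (`continuous_chi_smul`: the `H`-component of `χ(σ)·t` depends only on `χ_n(σ)` and `t mod n`, `n` the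
  index of `H`, both locally constant — the argument of `ZHatLevel.continuous_monoidHom` with a parameter);
* `GfpLat := Γ × Latt`, `actLat σ := θ_{χ(σ)} × actLatt σ`, **`PiTpLat p := GfpLat ⋊_{actLat} G_{ℚ_p}`** with the topology
  induced along `g ↦ (g.left, g.right)` — a topological group; `augLat := right` (continuous, onto `G_{ℚ_p}`);
* `PiHtLat p := (F̂₂ × Latt) ⋊ G_{ℚ_p}` (compact, Hausdorff, totally disconnected), `toHatLat := (pr₁ × id) ⋊ id` — injective and a
  PROFINITE COMPLETION (`IsProfiniteCompletion.prodMap` of `isProfiniteCompletion_gfpFst` with the identity of the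
  profinite `Latt`, then `Semidirect.isProfiniteCompletion_mapCont`);
* `curveLat p : TemperedCurve p` — `K := ℚ_p`, no closed points (as `curveχ`); `Δ^tp = GfpLat ⋊ 1`.
* THE SWAP `swapLatt : Latt ≃* Latt`, `(t₁, t₂) ↦ (t₂, t₁)`, commutes with the diagonal action (`actLatt_swapLatt`) — the
  germ of the automorphism used in file 3.

HONEST LABEL: a semi-synthetic model — consistency/independence evidence for OUR typed interface, NOT the tempered
fundamental group of a curve (the extra `Ẑ(1)²` is inert for everything printed); nothing of [EtTh] is asserted; it
decides (H1) at no genuine instance; nothing here bears on [IUTchIII] Cor. 3.12.  Class (b) MODEL/CONSTRUCTION file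
(def-bearing; instances only on the NEW carriers `PiTpLat`, `PiHtLat`; no notation; no `Prop`-valued definition).
-/

noncomputable section

namespace Literature.AnabelianGeometry.EtaleTheta.SettingModel

open Literature.AnabelianGeometry.SemiGraphs _root_.Topology _root_.Function
open CategoryTheory ProfiniteGrp ProfiniteGrp.ProfiniteCompletion

variable (p : ℕ) [Fact p.Prime]

/-! ### The Tate lattice `Ẑ(1)²` with the diagonal cyclotomic action -/

/-- The extra lattice `Latt := Ẑ × Ẑ` (two copies of the profinite completion of `ℤ`). [cite: MochizukiEtTh2009, §1 p.12] -/
abbrev Latt : Type := ZH × ZH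

/-- **The diagonal cyclotomic action** of `G_{ℚ_p}` on `Latt = Ẑ(1)²`: `σ ↦ χ(σ) × χ(σ)` (the tree's diagonal
embedding `diagAut : Aut(Ẑ) → Aut(Ẑ × Ẑ)` of `SettingModelChiShearInner.lean`, p430746, BY NAME). [cite: MochizukiEtTh2009, §1 p.13] -/
abbrev actLatt : GQp p →* MulAut Latt := diagAut.comp (chi p)

/-- `actLatt σ (t₁, t₂) = (χ(σ) t₁, χ(σ) t₂)`. [cite: MochizukiEtTh2009, §1 p.13] -/
theorem actLatt_apply (σ : GQp p) (t : Latt) : actLatt p σ t = (chi p σ t.1, chi p σ t.2) := rfl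

/-- **The swap** `(t₁, t₂) ↦ (t₂, t₁)` of the two lattice coordinates. [cite: MochizukiEtTh2009, §1 p.12] -/
def swapLatt : Latt ≃* Latt := MulEquiv.prodComm

/-- `swapLatt (t₁, t₂) = (t₂, t₁)`. [cite: MochizukiEtTh2009, §1 p.12] -/
@[simp] theorem swapLatt_apply (t : Latt) : swapLatt t = (t.2, t.1) := rfl

/-- The swap commutes with the diagonal action. [cite: MochizukiEtTh2009, §1 p.13] -/
theorem actLatt_swapLatt (σ : GQp p) (t : Latt) : actLatt p σ (swapLatt t) = swapLatt (actLatt p σ t) := rfl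

/-- The swap is continuous. [cite: MochizukiEtTh2009, §1 p.12] -/
theorem continuous_swapLatt : Continuous (swapLatt : Latt → Latt) := continuous_swap

/-- **Joint continuity of the cyclotomic action on `Ẑ`**: `(σ, t) ↦ χ(σ)·t` is continuous on `G_{ℚ_p} × Ẑ` — the
`H`-component of `χ(σ) t` only depends on the level character `χ_n(σ)` (locally constant in `σ`, abc-iut-w5-d091's
`isLocallyConstant_levelChar_chi`) and on `t mod n`, `n` the index of `H`. [cite: NeukirchANT1999, Ch. IV §1] -/
theorem continuous_chi_smul : Continuous fun q : GQp p × ZH => chi p q.1 q.2 := by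
  refine continuous_induced_rng.2 (continuous_pi fun H => ?_)
  haveI : DiscreteTopology ((diagram (GrpCat.of (Multiplicative ℤ))).obj H) := ⟨rfl⟩
  haveI : DiscreteTopology ((diagram (GrpCat.of (Multiplicative ℤ))).obj
      (ZHatLevel.kerLevel (ZHatLevel.indexPNat H))) := ⟨rfl⟩
  set n : ℕ+ := ZHatLevel.indexPNat H with hn
  have hcval : Continuous fun x : ZH => x.val (ZHatLevel.kerLevel n) :=
    Literature.AnabelianGeometry.AbsoluteAnabelian.ZHatCompletion.continuous_val (ZHatLevel.kerLevel n)
  refine continuous_def.2 fun U _ => isOpen_iff_forall_mem_open.2 fun q₀ hq₀ => ?_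
  refine ⟨{q | ZHatLevel.levelChar n (chi p q.1) = ZHatLevel.levelChar n (chi p q₀.1) ∧
      q.2.val (ZHatLevel.kerLevel n) = q₀.2.val (ZHatLevel.kerLevel n)}, ?_, ?_, ⟨rfl, rfl⟩⟩
  · rintro ⟨σ, x⟩ ⟨hσ, hx⟩
    have hx' : ZHatLevel.proj n x = ZHatLevel.proj n q₀.2 := hx
    have hlev : ZHatLevel.level n (chi p σ x) = ZHatLevel.level n (chi p q₀.1 q₀.2) := by
      apply Multiplicative.toAdd.injective
      rw [ZHatLevel.toAdd_level_aut, ZHatLevel.toAdd_level_aut, hσ,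
        ZHatLevel.proj_eq_iff_level_eq.mp hx']
    have hproj : ZHatLevel.proj n (chi p σ x) = ZHatLevel.proj n (chi p q₀.1 q₀.2) :=
      ZHatLevel.proj_eq_iff_level_eq.mpr hlev
    have hval : ((chi p σ x).val H : Multiplicative ℤ ⧸ H.toSubgroup) = (chi p q₀.1 q₀.2).val H := by
      rw [ZHatLevel.val_eq_map_proj (chi p σ x) H, ZHatLevel.val_eq_map_proj (chi p q₀.1 q₀.2) H]
      exact congrArg _ hproj
    show (chi p σ x).val H ∈ U
    rw [hval]
    exact hq₀
  · exact (((isLocallyConstant_levelChar_chi p n).isOpen_fiber _).preimage continuous_fst).inter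
      (((isOpen_discrete {q₀.2.val (ZHatLevel.kerLevel n)}).preimage hcval).preimage continuous_snd)

/-- Joint continuity of the diagonal action on `Latt`. [cite: MochizukiEtTh2009, §1 p.13] -/
theorem continuous_actLatt : Continuous fun q : GQp p × Latt => actLatt p q.1 q.2 := by
  have h1 := Continuous.comp (f := fun q : GQp p × Latt => (q.1, q.2.1))
    (g := fun q : GQp p × ZH => chi p q.1 q.2) (continuous_chi_smul p)
    (continuous_fst.prodMk (continuous_fst.comp continuous_snd))
  have h2 := Continuous.comp (f := fun q : GQp p × Latt => (q.1, q.2.2))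
    (g := fun q : GQp p × ZH => chi p q.1 q.2) (continuous_chi_smul p)
    (continuous_fst.prodMk (continuous_snd.comp continuous_snd))
  simp only [actLatt_apply]
  exact h1.prodMk h2

/-- Each `actLatt σ` is continuous. [cite: MochizukiEtTh2009, §1 p.13] -/
theorem continuous_actLatt_apply (σ : GQp p) : Continuous (actLatt p σ) := by
  have h := Continuous.comp (f := fun t : Latt => (σ, t)) (g := fun q : GQp p × Latt => actLatt p q.1 q.2)
    (continuous_actLatt p) (continuous_const.prodMk continuous_id)
  exact h

/-! ### `Π^tp_X := (Γ × Ẑ(1)²) ⋊_χ G_{ℚ_p}` -/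

/-- The normal factor `Γ × Latt` of the tempered carrier. [cite: MochizukiEtTh2009, §1 p.12] -/
abbrev GfpLat : Type := Gfp × Latt

/-- The action of `G_{ℚ_p}` on `Γ × Latt`: `σ ↦ θ_{χ(σ)} × (χ(σ) × χ(σ))`. [cite: MochizukiEtTh2009, §1 p.12] -/
def actLat : GQp p →* MulAut GfpLat where
  toFun σ := MulEquiv.prodCongr (actχ p σ) (actLatt p σ)
  map_one' := MulEquiv.ext fun x => by
    show (actχ p 1 x.1, actLatt p 1 x.2) = x
    rw [map_one (actχ p), map_one (actLatt p)]; rfl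
  map_mul' σ τ := MulEquiv.ext fun x => by
    show (actχ p (σ * τ) x.1, actLatt p (σ * τ) x.2) = (actχ p σ (actχ p τ x.1), actLatt p σ (actLatt p τ x.2))
    rw [map_mul (actχ p), map_mul (actLatt p)]; rfl

/-- `actLat σ (γ, t) = (θ_{χσ} γ, actLatt σ t)`. [cite: MochizukiEtTh2009, §1 p.12] -/
@[simp] theorem actLat_apply (σ : GQp p) (x : GfpLat) : actLat p σ x = (actχ p σ x.1, actLatt p σ x.2) := rfl

/-- **`Π^tp_X` of the lattice model**: `(Γ × Ẑ(1)²) ⋊_{actLat} G_{ℚ_p}`. [cite: MochizukiEtTh2009, §1 p.12] -/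
abbrev PiTpLat : Type := GfpLat ⋊[actLat p] GQp p

/-- The topology of `Π^tp_X`: induced along `g ↦ (g.left, g.right)`. [cite: MochizukiEtTh2009, §1 p.12] -/
instance instTopologicalSpacePiTpLat : TopologicalSpace (PiTpLat p) :=
  TopologicalSpace.induced (fun g : PiTpLat p => (g.left, g.right)) inferInstance

/-- `g ↦ (g.left, g.right)` is inducing. [cite: MochizukiEtTh2009, §1 p.12] -/
theorem isInducing_leftRightLat : IsInducing fun g : PiTpLat p => (g.left, g.right) := ⟨rfl⟩

/-- The action `actLat` is jointly continuous. [cite: MochizukiEtTh2009, §1 p.12] -/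
theorem continuous_actLat : Continuous fun q : GQp p × GfpLat => actLat p q.1 q.2 := by
  have h1 := Continuous.comp (f := fun q : GQp p × GfpLat => (q.1, q.2.1))
    (g := fun q : GQp p × Gfp => actχ p q.1 q.2) (continuous_actχ p)
    (continuous_fst.prodMk (continuous_fst.comp continuous_snd))
  have h2 := Continuous.comp (f := fun q : GQp p × GfpLat => (q.1, q.2.2))
    (g := fun q : GQp p × Latt => actLatt p q.1 q.2) (continuous_actLatt p)
    (continuous_fst.prodMk (continuous_snd.comp continuous_snd))
  simp only [actLat_apply]
  exact h1.prodMk h2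

/-- **`Π^tp_X` is a topological group.** [cite: MochizukiEtTh2009, §1 p.12] -/
instance instIsTopologicalGroupPiTpLat : IsTopologicalGroup (PiTpLat p) :=
  Semidirect.isTopologicalGroup_of_continuous_action (isInducing_leftRightLat p) (continuous_actLat p)

/-- **The augmentation `Π^tp_X → G_{ℚ_p}`**: `g ↦ g.right`. [cite: MochizukiEtTh2009, §1 p.12] -/
def augLat : PiTpLat p →ₜ* GQp p := Semidirect.rightHomCont (isInducing_leftRightLat p)

/-- [cite: MochizukiEtTh2009, §1 p.12] -/
@[simp] theorem augLat_apply (g : PiTpLat p) : augLat p g = g.right := rfl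

/-- The augmentation is onto `G_{ℚ_p} = G_K` (`K = ℚ_p`). [cite: MochizukiEtTh2009, §1 p.12] -/
theorem range_augLat : (augLat p).toMonoidHom.range = ⊤ :=
  MonoidHom.range_eq_top.mpr fun σ => ⟨SemidirectProduct.inr σ, rfl⟩

/-! ### `Π_X := (F̂₂ × Ẑ(1)²) ⋊_χ G_{ℚ_p}` and the completion map -/

/-- The normal factor `F̂₂ × Latt` of the profinite carrier. [cite: MochizukiEtTh2009, §1 p.12] -/
abbrev GfpLatHat : Type := F₂hatT × Latt

/-- The action of `G_{ℚ_p}` on `F̂₂ × Latt`: `σ ↦ θ_{χ(σ)} × (χ(σ) × χ(σ))`. [cite: MochizukiEtTh2009, §1 p.12] -/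
def actLatHat : GQp p →* MulAut GfpLatHat where
  toFun σ := MulEquiv.prodCongr (actHatχ p σ) (actLatt p σ)
  map_one' := MulEquiv.ext fun x => by
    show (actHatχ p 1 x.1, actLatt p 1 x.2) = x
    rw [map_one (actHatχ p), map_one (actLatt p)]; rfl
  map_mul' σ τ := MulEquiv.ext fun x => by
    show (actHatχ p (σ * τ) x.1, actLatt p (σ * τ) x.2) =
      (actHatχ p σ (actHatχ p τ x.1), actLatt p σ (actLatt p τ x.2))
    rw [map_mul (actHatχ p), map_mul (actLatt p)]; rfl

/-- `actLatHat σ (x, t) = (θ_{χσ} x, actLatt σ t)`. [cite: MochizukiEtTh2009, §1 p.12] -/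
@[simp] theorem actLatHat_apply (σ : GQp p) (x : GfpLatHat) :
    actLatHat p σ x = (actHatχ p σ x.1, actLatt p σ x.2) := rfl

/-- **`Π_X` of the lattice model**: `(F̂₂ × Ẑ(1)²) ⋊ G_{ℚ_p}`. [cite: MochizukiEtTh2009, §1 p.12] -/
abbrev PiHtLat : Type := GfpLatHat ⋊[actLatHat p] GQp p

/-- The topology of `Π_X`: induced along `g ↦ (g.left, g.right)`. [cite: MochizukiEtTh2009, §1 p.12] -/
instance instTopologicalSpacePiHtLat : TopologicalSpace (PiHtLat p) :=
  TopologicalSpace.induced (fun g : PiHtLat p => (g.left, g.right)) inferInstance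

/-- [cite: MochizukiEtTh2009, §1 p.12] -/
theorem isInducing_leftRightHatLat : IsInducing fun g : PiHtLat p => (g.left, g.right) := ⟨rfl⟩

/-- The action `actLatHat` is jointly continuous. [cite: MochizukiEtTh2009, §1 p.12] -/
theorem continuous_actLatHat : Continuous fun q : GQp p × GfpLatHat => actLatHat p q.1 q.2 := by
  have h1 := Continuous.comp (f := fun q : GQp p × GfpLatHat => (q.1, q.2.1))
    (g := fun q : GQp p × F₂hatT => actHatχ p q.1 q.2) (continuous_actHatχ p)
    (continuous_fst.prodMk (continuous_fst.comp continuous_snd))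
  have h2 := Continuous.comp (f := fun q : GQp p × GfpLatHat => (q.1, q.2.2))
    (g := fun q : GQp p × Latt => actLatt p q.1 q.2) (continuous_actLatt p)
    (continuous_fst.prodMk (continuous_snd.comp continuous_snd))
  simp only [actLatHat_apply]
  exact h1.prodMk h2

/-- `Π_X` is a topological group. [cite: MochizukiEtTh2009, §1 p.12] -/
instance instIsTopologicalGroupPiHtLat : IsTopologicalGroup (PiHtLat p) :=
  Semidirect.isTopologicalGroup_of_continuous_action (isInducing_leftRightHatLat p) (continuous_actLatHat p)

/-- `Π_X` is compact. [cite: MochizukiEtTh2009, §1 p.12] -/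
instance instCompactSpacePiHtLat : CompactSpace (PiHtLat p) := by
  haveI := compactSpace_GQp p
  exact Semidirect.compactSpace_of (isInducing_leftRightHatLat p)

/-- `Π_X` is Hausdorff. [cite: MochizukiEtTh2009, §1 p.12] -/
instance instT2SpacePiHtLat : T2Space (PiHtLat p) := by
  haveI : T2Space (GQp p) := krullTopology_t2
  exact Semidirect.t2Space_of (isInducing_leftRightHatLat p)

/-- `Π_X` is totally disconnected. [cite: MochizukiEtTh2009, §1 p.12] -/
instance instTotallyDisconnectedSpacePiHtLat : TotallyDisconnectedSpace (PiHtLat p) := by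
  haveI := totallyDisconnectedSpace_GQp p
  exact Semidirect.totallyDisconnectedSpace_of (isInducing_leftRightHatLat p)

/-- `pr₁ × id : Γ × Latt → F̂₂ × Latt`, continuous homomorphism. [cite: MochizukiEtTh2009, §1 p.12] -/
def gfpLatFst : GfpLat →ₜ* GfpLatHat := gfpFst.prodMap (ContinuousMonoidHom.id Latt)

/-- [cite: MochizukiEtTh2009, §1 p.12] -/
@[simp] theorem gfpLatFst_apply (x : GfpLat) : gfpLatFst x = (gfpFst x.1, x.2) := rfl

/-- `pr₁ × id` intertwines the two actions. [cite: MochizukiEtTh2009, §1 p.12] -/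
theorem gfpLatFst_actLat (σ : GQp p) (x : GfpLat) : gfpLatFst (actLat p σ x) = actLatHat p σ (gfpLatFst x) := rfl

/-- `pr₁ × id` is injective. [cite: MochizukiEtTh2009, §1 p.12] -/
theorem gfpLatFst_injective : Injective (gfpLatFst : GfpLat → GfpLatHat) := by
  intro x y h
  rw [gfpLatFst_apply, gfpLatFst_apply, Prod.mk.injEq] at h
  exact Prod.ext (gfpFst_injective h.1) h.2

/-- `pr₁ × id` is a profinite completion (`Latt` is profinite and complete). [cite: MochizukiSemiAnbd2006, §6 p.69] -/
theorem isProfiniteCompletion_gfpLatFst : IsProfiniteCompletion gfpLatFst :=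
  isProfiniteCompletion_gfpFst.prodMap (isProfiniteCompletion_id Latt)

/-- **`Π^tp_X → Π_X`**: `(pr₁ × id) ⋊ id`. [cite: MochizukiEtTh2009, §1 p.12] -/
def toHatLat : PiTpLat p →ₜ* PiHtLat p :=
  Semidirect.mapCont (isInducing_leftRightLat p) (isInducing_leftRightHatLat p) gfpLatFst (gfpLatFst_actLat p)

/-- [cite: MochizukiEtTh2009, §1 p.12] -/
@[simp] theorem toHatLat_left (g : PiTpLat p) : (toHatLat p g).left = gfpLatFst g.left := rfl

/-- [cite: MochizukiEtTh2009, §1 p.12] -/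
@[simp] theorem toHatLat_right (g : PiTpLat p) : (toHatLat p g).right = g.right := rfl

/-- `Π^tp_X → Π_X` is injective. [cite: MochizukiEtTh2009, §1 p.12] -/
theorem toHatLat_injective : Injective (toHatLat p) :=
  Semidirect.mapCont_injective _ _ _ _ gfpLatFst_injective

/-- The profinite augmentation `Π_X → G_{ℚ_p}`. [cite: MochizukiEtTh2009, §1 p.12] -/
def augHatLat : PiHtLat p →ₜ* GQp p := Semidirect.rightHomCont (isInducing_leftRightHatLat p)

/-- [cite: MochizukiEtTh2009, §1 p.12] -/
@[simp] theorem augHatLat_apply (g : PiHtLat p) : augHatLat p g = g.right := rfl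

/-- `augHat ∘ toHat = aug`. [cite: MochizukiEtTh2009, §1 p.12] -/
theorem augHatLat_toHatLat (g : PiTpLat p) : augHatLat p (toHatLat p g) = augLat p g := rfl

/-- **`Π_X = (Π^tp_X)^∧`** for the lattice model. [cite: MochizukiEtTh2009, §1 p.12] -/
theorem isProfiniteCompletion_toHatLat : IsProfiniteCompletion (toHatLat p) := by
  haveI := compactSpace_GQp p
  haveI : T2Space (GQp p) := krullTopology_t2
  haveI := totallyDisconnectedSpace_GQp p
  exact Semidirect.isProfiniteCompletion_mapCont (isInducing_leftRightLat p) (isInducing_leftRightHatLat p)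
    gfpLatFst (gfpLatFst_actLat p) isProfiniteCompletion_gfpLatFst
    (fun σ => ((twist (chi p σ)).continuous).prodMap (continuous_actLatt_apply p σ))

/-! ### The tempered-curve layer -/

/-- **The tempered-curve layer of the lattice model**: `K := ℚ_p`, `Π^tp := (Γ × Ẑ(1)²) ⋊_χ G_{ℚ_p}`,
`Π := (F̂₂ × Ẑ(1)²) ⋊_χ G_{ℚ_p}`, no closed points. [cite: MochizukiEtTh2009, §1 p.11] -/
abbrev curveLat : TemperedCurve p where
  K := ⊥
  finiteDimensional_K := inferInstance
  PiTemp := PiTpLat p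
  aug := augLat p
  range_aug := by
    rw [IntermediateField.fixingSubgroup_bot]
    exact range_augLat p
  PiHat := PiHtLat p
  toHat := toHatLat p
  isProfiniteCompletion_toHat := isProfiniteCompletion_toHatLat p
  toHat_injective := toHatLat_injective p
  augHat := augHatLat p
  augHat_comp _ := rfl
  Pt := PEmpty
  IsCusp _ := False
  decomp x := x.elim
  isClosed_decomp x := x.elim
  isOpen_aug_decomp x := x.elim
  inertia_eq_bot x := x.elim
  inertia_equiv_zHat x := x.elim

/-- `Δ^tp_X = Ker(aug) = {g | g.right = 1}`. [cite: MochizukiEtTh2009, §1 p.12] -/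
theorem mem_deltaTempLat_iff (g : PiTpLat p) : g ∈ (curveLat p).DeltaTemp ↔ g.right = 1 := Iff.rfl

/-- `inl x ∈ Δ^tp_X`. [cite: MochizukiEtTh2009, §1 p.12] -/
theorem inl_mem_deltaTempLat (x : GfpLat) : (SemidirectProduct.inl x : PiTpLat p) ∈ (curveLat p).DeltaTemp :=
  (mem_deltaTempLat_iff p _).mpr rfl

/-- The swap of the two lattice coordinates as an automorphism of `Γ × Latt` commuting with the action — the germ
of the automorphism `id ⋉ swap` of `Π^tp_X` used in file 3. [cite: MochizukiEtTh2009, §1 p.12] -/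
def swapGfpLat : GfpLat ≃* GfpLat := (MulEquiv.refl Gfp).prodCongr swapLatt

/-- `swapGfpLat` commutes with the action `actLat`. [cite: MochizukiEtTh2009, §1 p.12] -/
theorem actLat_swapGfpLat (σ : GQp p) (x : GfpLat) : actLat p σ (swapGfpLat x) = swapGfpLat (actLat p σ x) := rfl

end Literature.AnabelianGeometry.EtaleTheta.SettingModel

end
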